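import Summits.ABC.StewartYu.PadicG3TwoFunctions
import Summits.ABC.StewartYu.PadicTwoSeries
import HarnessLib

/-!
# Cell abc-stewartyu, Gen-3 frame at `p = 2` (crux `Y07Two`, stmt-ABC-19659), layer F4a: the auxiliary
# functions `f_τ` as POWER SERIES on `‖z‖ < 4` — coefficients, the weighted bound at radius `4`, jets

`Summits/ABC/StewartYu/PadicG3TwoSeries.lean` — cell `abc-stewartyu` (HOME `run/shared/lean/pub/abc-stewartyu/`),
route `PadicPrimesKummerThird`, seat p3 (g5), F-two LEAD (layer plan HOME/p3/memo-09 §3, F4).  Definitions and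
theorems on the M2 datum `TwoSetup`; no named fact.  Twin of lit's `PadicTwoSeries.lean` for the Gen-3 family
`g3F` of `PadicG3TwoFunctions` (arbitrary finite unknown family with signed exponents, arbitrary `Y₀`-factors
`Rᵢ` with Hasse weights): `f_τ(z) = ∑ₙ coeffG3F n · zⁿ` on `‖z‖ < 4` (`hasSum_coeffG3F`) with the weighted
bound `‖coeffG3F n‖·4ⁿ ≤ Bw` (`wtBdd_coeffG3F`) as soon as the `Y₀`-weight polynomials satisfy
`‖coeffₖ(Hasse_{t₀} Rᵢ)‖₂·4ᵏ ≤ Bw` (the frame's Fel'dman-basis size; `‖zexpo‖ ≤ 8⁻¹`, `‖1/j!‖₂ ≤ 2ʲ` give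
`‖zexpoʲ/j!‖·4ʲ ≤ 1`), so the small-jets Schwarz lemma (`PadicNewton.norm_tsum_le_max_of_small_jets_levels`,
`ρ = 4`) applies, with jets controlled by values (`norm_jet_g3F_le`).

WHAT THIS IS NOT: no extrapolation step yet (F4b = the twin of `PadicTwoKStep.norm_Φ_le_of_zeros3` on these
series); no crux moves.

References: K. Yu, Compositio Math. 74 (1990), §1.1, Lemmas 2.2–2.4; K. Yu, Acta Math. 211 (2013), Lemma 5.2.
-/

noncomputable section

open NormedSpace Finset IsUltrametricDist Polynomial Metric Filter
open Literature.NumberTheory.Transcendental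
open Literature.NumberTheory.Transcendental.CW77.Setup (Tau tauNorm)
open scoped Nat Topology

namespace Summit.ABC.StewartYu

namespace TwoSetup

variable (S : TwoSetup) {ι : Type*} (R : ι → ℚ[X]) (u : ι → Fin S.d → ℤ) (uθ : ι → ℤ)

/-! ### The coefficients -/

/-- The coefficients of `exp(zexpo(i)·z)`: `zexpo(i)^j / j!`. [cite: Yu1990, §1.1] -/
def g3eC (i : ι) (j : ℕ) : ℚ_[2] := S.zexpo (u i) (uθ i) ^ j / (j ! : ℚ_[2])

/-- The coefficients of the `Y₀`-weight polynomial `Hasse_{t₀} Rᵢ` (in `ℚ₂`). [cite: Yu2013, (5.4)] -/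
def g3wC (i : ι) (t₀ k : ℕ) : ℚ_[2] := (hw R i t₀).coeff k

/-- The degree bound used to truncate. [folklore] -/
def g3wDeg (i : ι) (t₀ : ℕ) : ℕ := (hw R i t₀).natDegree

/-- **The coefficient sequence of `f_τ`**:
`coeffG3F n = ∑_i pᵢ · ∏ zγⱼ^{tⱼ} · ∑_{k ≤ deg, k ≤ n} g3wC k · g3eC (n − k)`. [cite: Yu1990, Lemma 2.2] -/
def coeffG3F (B : Finset ι) (p : ι → ℤ) (τ : Tau S.d) (n : ℕ) : ℚ_[2] :=
  ∑ i ∈ B, (p i : ℚ_[2]) * (S.zγpow u uθ i τ.2 : ℚ_[2]) *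
    ∑ k ∈ range (g3wDeg R i τ.1 + 1), if k ≤ n then g3wC R i τ.1 k * S.g3eC u uθ i (n - k) else 0

/-! ### Convergence to `f_τ` on `‖z‖ < 4` -/

/-- `exp(zexpo·z) = ∑ⱼ g3eC j zʲ` for `‖z‖ < 4`. [cite: Yu1990, §1.1] -/
theorem hasSum_g3eC (i : ι) {z : ℚ_[2]} (hz : ‖z‖ < 4) :
    HasSum (fun j => S.g3eC u uθ i j * z ^ j) (exp (S.zexpo (u i) (uθ i) * z)) := by
  have hmem := mem_eball_of_norm_lt (S.norm_zexpo_le (u i) (uθ i)) hz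
  rw [smul_eq_mul, mul_comm] at hmem
  have h := expSeries_hasSum_exp_of_mem_ball' (𝕂 := ℚ_[2]) (S.zexpo (u i) (uθ i) * z) hmem
  refine h.congr_fun fun j => ?_
  rw [inv_natCast_smul_eq ℚ_[2] ℚ_[2], smul_eq_mul, g3eC, mul_pow]
  field_simp

/-- `(hw i t₀)(z) = ∑_{k ≤ deg} g3wC k zᵏ`. [folklore] -/
theorem hw_eval_eq_sum (i : ι) (t₀ : ℕ) (z : ℚ_[2]) :
    (hw R i t₀).eval z = ∑ k ∈ range (g3wDeg R i t₀ + 1), g3wC R i t₀ k * z ^ k := by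
  unfold g3wDeg g3wC
  rw [Polynomial.eval_eq_sum_range]

/-- One shifted series: `∑ₙ [k ≤ n] g3wC k · g3eC (n−k) zⁿ = g3wC k zᵏ · exp(zexpo z)` (`‖z‖ < 4`).
[cite: Yu1990, Lemma 2.2] -/
theorem hasSum_g3shift (i : ι) (t₀ k : ℕ) {z : ℚ_[2]} (hz : ‖z‖ < 4) :
    HasSum (fun n => (if k ≤ n then g3wC R i t₀ k * S.g3eC u uθ i (n - k) else 0) * z ^ n)
      (g3wC R i t₀ k * z ^ k * exp (S.zexpo (u i) (uθ i) * z)) := by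
  have h := (S.hasSum_g3eC u uθ i hz).mul_left (g3wC R i t₀ k * z ^ k)
  rw [← hasSum_nat_add_iff' k]
  have h0 : ∑ n ∈ range k, (if k ≤ n then g3wC R i t₀ k * S.g3eC u uθ i (n - k) else 0) * z ^ n = 0 :=
    sum_eq_zero fun n hn => by rw [if_neg (by have := mem_range.mp hn; omega), zero_mul]
  rw [h0, sub_zero]
  refine h.congr_fun fun n => ?_
  rw [if_pos (by omega), Nat.add_sub_cancel, pow_add]
  ring

/-- One term: `∑ₙ (∑ₖ [k ≤ n] g3wC k g3eC (n−k)) zⁿ = (hw i t₀)(z) · exp(zexpo z)` (`‖z‖ < 4`).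
[cite: Yu1990, Lemma 2.2] -/
theorem hasSum_g3term (i : ι) (τ : Tau S.d) {z : ℚ_[2]} (hz : ‖z‖ < 4) :
    HasSum (fun n => (∑ k ∈ range (g3wDeg R i τ.1 + 1),
        (if k ≤ n then g3wC R i τ.1 k * S.g3eC u uθ i (n - k) else 0)) * z ^ n)
      ((hw R i τ.1).eval z * exp (S.zexpo (u i) (uθ i) * z)) := by
  have h := hasSum_sum fun k (_ : k ∈ range (g3wDeg R i τ.1 + 1)) => S.hasSum_g3shift R u uθ i τ.1 k hz
  rw [hw_eval_eq_sum, sum_mul]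
  refine h.congr_fun fun n => ?_
  rw [sum_mul]

/-- **`f_τ(z) = ∑ₙ coeffG3F n zⁿ` on `‖z‖ < 4`.** [cite: Yu1990, Lemma 2.2] -/
theorem hasSum_coeffG3F (B : Finset ι) (p : ι → ℤ) (τ : Tau S.d) {z : ℚ_[2]} (hz : ‖z‖ < 4) :
    HasSum (fun n => S.coeffG3F R u uθ B p τ n * z ^ n) (S.g3F R u uθ B p τ z) := by
  unfold g3F coeffG3F
  have h := hasSum_sum fun i (_ : i ∈ B) =>
    (S.hasSum_g3term R u uθ i τ hz).mul_left ((p i : ℚ_[2]) * (S.zγpow u uθ i τ.2 : ℚ_[2]))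
  have e : ∑ i ∈ B, (p i : ℚ_[2]) * (S.zγpow u uθ i τ.2 : ℚ_[2]) *
      ((hw R i τ.1).eval z * exp (S.zexpo (u i) (uθ i) * z)) =
      ∑ i ∈ B, (p i : ℚ_[2]) * S.g3termF R u uθ i τ z :=
    sum_congr rfl fun i _ => by simp only [g3termF]; ring
  rw [← e]
  refine h.congr_fun fun n => ?_
  rw [sum_mul]
  exact sum_congr rfl fun i _ => by ring

/-- `f_τ(z) = ∑' coeffG3F n zⁿ` on `‖z‖ < 4`. [cite: Yu1990, Lemma 2.2] -/
theorem g3F_eq_tsum (B : Finset ι) (p : ι → ℤ) (τ : Tau S.d) {z : ℚ_[2]} (hz : ‖z‖ < 4) :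
    S.g3F R u uθ B p τ z = ∑' n, S.coeffG3F R u uθ B p τ n * z ^ n :=
  (S.hasSum_coeffG3F R u uθ B p τ hz).tsum_eq.symm

/-- `f_τ` agrees with its power series near every point of `‖z‖ < 4`. [cite: Yu1990, Lemma 2.2] -/
theorem g3F_eventuallyEq_tsum (B : Finset ι) (p : ι → ℤ) (τ : Tau S.d) {a : ℚ_[2]} (ha : ‖a‖ < 4) :
    S.g3F R u uθ B p τ =ᶠ[𝓝 a] fun z => ∑' n, S.coeffG3F R u uθ B p τ n * z ^ n := by
  have hball : {z : ℚ_[2] | ‖z‖ < 4} ∈ 𝓝 a := by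
    have : {z : ℚ_[2] | ‖z‖ < 4} = Metric.ball 0 4 := by
      ext z; simp
    rw [this]
    exact Metric.isOpen_ball.mem_nhds (by simpa using ha)
  filter_upwards [hball] with z hz using S.g3F_eq_tsum R u uθ B p τ hz

/-! ### The weighted bound `‖coeffG3F n‖ 4ⁿ ≤ Bw` -/

/-- `‖g3eC j‖ 4ʲ ≤ 1` (`‖zexpo‖ ≤ 8⁻¹`, `‖1/j!‖₂ ≤ 2ʲ`). [cite: Yu1990, §1.1] -/
theorem norm_g3eC_mul_le (i : ι) (j : ℕ) : ‖S.g3eC u uθ i j‖ * 4 ^ j ≤ 1 := by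
  unfold g3eC
  rw [div_eq_mul_inv, norm_mul, norm_pow, show ((j ! : ℚ_[2])) = ((j ! : ℕ) : ℚ_[2]) by norm_cast]
  have h1 : ‖S.zexpo (u i) (uθ i)‖ ^ j ≤ ((8 : ℝ)⁻¹) ^ j :=
    pow_le_pow_left₀ (norm_nonneg _) (S.norm_zexpo_le _ _) j
  have h2 := norm_inv_factorial_le_two_pow j
  calc ‖S.zexpo (u i) (uθ i)‖ ^ j * ‖((j ! : ℕ) : ℚ_[2])⁻¹‖ * 4 ^ j
      ≤ ((8 : ℝ)⁻¹) ^ j * (2 : ℝ) ^ j * 4 ^ j := by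
        refine mul_le_mul_of_nonneg_right (mul_le_mul h1 h2 (norm_nonneg _) (by positivity)) ?_
        positivity
    _ = 1 := by rw [← mul_pow, ← mul_pow]; norm_num

/-- **The weighted coefficient bound** from the frame's bound on the `Y₀`-weights:
if `‖coeffₖ(hw i t₀)‖·4ᵏ ≤ Bw` for all `i ∈ B`, `k`, then `WtBdd 4 Bw coeffG3F`
(ultrametric: `pᵢ ∈ ℤ`, `‖∏ zγ^t‖ ≤ 1`, `‖g3eC j‖ 4ʲ ≤ 1`). [cite: Yu1990, Lemma 2.2] -/
theorem wtBdd_coeffG3F (B : Finset ι) (p : ι → ℤ) (τ : Tau S.d) {Bw : ℝ} (hBw0 : 0 ≤ Bw)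
    (hBw : ∀ i ∈ B, ∀ k, ‖(hw R i τ.1).coeff k‖ * 4 ^ k ≤ Bw) :
    PadicNewton.WtBdd 4 Bw (S.coeffG3F R u uθ B p τ) := by
  intro n
  have hsp : (0 : ℝ) < 4 ^ n := pow_pos (by norm_num) n
  rw [← le_div_iff₀ hsp]
  have hB : 0 ≤ Bw / 4 ^ n := by positivity
  unfold coeffG3F
  refine norm_sum_le_of_forall_le_of_nonneg hB fun i hi => ?_
  rw [norm_mul, norm_mul]
  refine (mul_le_of_le_one_left (norm_nonneg _)
    (mul_le_one₀ (Padic.norm_int_le_one _) (norm_nonneg _) (S.norm_zγpow_le u uθ i τ.2))).trans ?_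
  refine norm_sum_le_of_forall_le_of_nonneg hB fun k _ => ?_
  split_ifs with hkn
  · rw [le_div_iff₀ hsp, norm_mul]
    have e : (4 : ℝ) ^ n = 4 ^ k * 4 ^ (n - k) := by
      rw [← pow_add, Nat.add_sub_cancel' hkn]
    rw [e]
    calc ‖g3wC R i τ.1 k‖ * ‖S.g3eC u uθ i (n - k)‖ * ((4 : ℝ) ^ k * 4 ^ (n - k))
        = (‖g3wC R i τ.1 k‖ * 4 ^ k) * (‖S.g3eC u uθ i (n - k)‖ * 4 ^ (n - k)) := by ring
      _ ≤ Bw * 1 :=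
          mul_le_mul (hBw i hi k) (S.norm_g3eC_mul_le u uθ i (n - k)) (by positivity) hBw0
      _ = Bw := mul_one _
  · rw [norm_zero]; exact hB

/-! ### Jets of `f_τ` from the values of the `f_τ'` -/

/-- **The jets of `f_τ` at a node are controlled by the values of the family there**: if
`‖f_τ'(a)‖ ≤ ε` for all `|τ'| ≤ N` (`‖a‖ ≤ 2`), then for `|τ| + k ≤ N` the `k`-th jet of the power series
of `f_τ` at `a` has norm `≤ ‖(k!)⁻¹‖₂·ε` — the hypothesis `hjet` of the small-jets Schwarz lemma.
[cite: Yu1990, Lemma 2.4] -/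
theorem norm_jet_g3F_le (B : Finset ι) (p : ι → ℤ) {Bw : ℝ} (hBw0 : 0 ≤ Bw)
    {a : ℚ_[2]} (ha : ‖a‖ ≤ 2) (N : ℕ) {ε : ℝ} (hε0 : 0 ≤ ε)
    (hε : ∀ τ : Tau S.d, tauNorm τ ≤ N → ‖S.g3F R u uθ B p τ a‖ ≤ ε)
    (k : ℕ) (τ : Tau S.d) (hBw : ∀ i ∈ B, ∀ k', ‖(hw R i τ.1).coeff k'‖ * 4 ^ k' ≤ Bw)
    (hk : tauNorm τ + k ≤ N) :
    ‖PadicNewton.jet a (S.coeffG3F R u uθ B p τ) k‖ ≤ ‖((k ! : ℕ) : ℚ_[2])⁻¹‖ * ε := by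
  have ha' : ‖a‖ < 4 := lt_of_le_of_lt ha (by norm_num)
  have hb := S.wtBdd_coeffG3F R u uθ B p τ hBw0 hBw
  have hj := PadicNewton.norm_jet_le_norm_iteratedDeriv (by norm_num : (0 : ℝ) < 4)
    (by norm_num : (2 : ℝ) < 4) two_pos hb ha k
  refine hj.trans (mul_le_mul_of_nonneg_left ?_ (norm_nonneg _))
  rw [← (S.g3F_eventuallyEq_tsum R u uθ B p τ ha').iteratedDeriv_eq k]
  exact S.norm_iteratedDeriv_g3F_le_of_forall R u uθ B p ha' N hε0 hε k τ hk

end TwoSetup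

end Summit.ABC.StewartYu

end
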